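import Literature.MathematicalPhysics.QuantumFieldTheory.Balaban1983to89.B12Decay510
import Literature.MathematicalPhysics.QuantumFieldTheory.Balaban1983to89.Node00.Sect2FrameOfRecord

/-! # CRIT-1 g32 — junk probe of the T1 ∕ (S1) text shapes (byte copy of lens-1 g2 `nodeO-cover/LENS-1-T1KitProbe-v1.lean`
sha16 9b8adb2c28a0e35e, namespace renamed `WT1` → `…Crit1T1Junk`, plus the two junk instances at the end).

FINDING (kernel-checked below): with PER-ITEM data `D`, `T1Text` is inhabited by `E := 0, Uc := ∅` for EVERY `E₀ κ`, and by
`E := 0, Uc := univ` for every `0 ≤ E₀`; hence the T1 text carries content ONLY jointly with (S1)'s equation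
`Φf K B = Σ_X D.E K X (χ K X (ι K B))` for the RECORD's (non-zero) functional `Φf` and with 27932′'s `ball ⊆ Uc` on the SAME `Uc`.
TYPING CONDITIONS that follow: (J1) one SHARED data object — DEF-1 definitions by name, or ONE ∃ over the data inside a single
conjunctive item — never a per-item ∃ over data; (J2) `Φf` := the record's effective action by tree name; (J3) `E₀ κ` := the absolute
(1.18) constants of record ([I] p.263 L22–29), not `∃ E₀ κ` inside `∀ K`; (J4) 27932′'s chart-image condition constrains T1's `Uc`.
Nothing of Bałaban is asserted here; stub 2′ UNPORTED; K0⁷ open; YM mass gap NOT proved. -/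
noncomputable section
open Filter Topology Metric
open scoped BigOperators
namespace Summit.QuantumFields.YangMills.Cruxes.Record13SepCoPHInhabited.Crit1T1Junk
open Literature.MathematicalPhysics.QuantumFieldTheory.Balaban1983to89
open Literature.MathematicalPhysics.QuantumFieldTheory.Balaban1983to89.Node00
open Literature.MathematicalPhysics.QuantumFieldTheory.Balaban1983to89.T4Continuum (T4Family)

structure FmtDataOver (S : ℕ → LocDomainSys) where
  M : ℕ → ℕ
  E : (K : ℕ) → (S K).Dom → (Fin (M K) → ℂ) → ℂ
  Uc : (K : ℕ) → (S K).Dom → Set (Fin (M K) → ℂ)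
  coordsOf : (K : ℕ) → (S K).Dom → Finset (Fin (M K))

abbrev recordDomSys (F : T4Family) (Mc k : ℕ) : ℕ → LocDomainSys := fun K => Sect2.domSys (F.P K) Mc (k + 1)

variable (F : T4Family) (Mc k : ℕ) (D : FmtDataOver (recordDomSys F Mc k)) (m : ℕ → ℕ)
  (χ : (K : ℕ) → (recordDomSys F Mc k K).Dom → (Fin (m K) → ℂ) → (Fin (D.M K) → ℂ))
  (W : ℕ → Type) [∀ K, NormedAddCommGroup (W K)] (Φf : (K : ℕ) → W K → ℂ) (ι : (K : ℕ) → W K → (Fin (m K) → ℂ)) (E₀ κ : ℝ)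

/-- T1 text shape against the record's index -/
def T1Text : Prop :=
  (∀ K X, AnalyticOnNhd ℂ (D.E K X) (D.Uc K X)) ∧ (∀ K X, ∀ u ∈ D.Uc K X, ‖D.E K X u‖ ≤ E₀ * Real.exp (-κ * (recordDomSys F Mc k K).dj X)) ∧
  (∀ K X u u', (∀ i ∈ D.coordsOf K X, u i = u' i) → D.E K X u = D.E K X u')

/-- 27930′ text shape against the record's index: the sum over 𝐃_{k+1}(T^{(K)}) elaborates (Fintype found) -/
def S1Text : Prop := ∀ K, ∀ᶠ B in 𝓝 (0 : W K), Φf K B = ∑ X : (recordDomSys F Mc k K).Dom, D.E K X (χ K X (ι K B))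

/-- the index really is the torus catalogue: `d_{k+1}(X) = torusTreeLen X` by `rfl` -/
example (K : ℕ) (X : (recordDomSys F Mc k K).Dom) : (recordDomSys F Mc k K).dj X = TreeLengthTorus.torusTreeLen X.1 := rfl

/-- and the domain count is the record's: the whole torus of `Mc`-cubes is ONE of the domains iff connected — here just: the index type is `TDom 4 _` -/
example (K : ℕ) : (recordDomSys F Mc k K).Dom = TreeLengthTorus.TDom 4 (Sect2.domCount (F.P K) Mc (k + 1)) := rfl


/-! CRIT-1 g32 junk probe: with PER-ITEM data the T1 text is junk-inhabited (E := 0, Uc := ∅), for EVERY E₀ κ —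
so T1's content lives only in the conjunction with (S1)'s equation for the RECORD's Φf and 27932′'s `ball ⊆ Uc`. -/
def junkD : FmtDataOver (recordDomSys F Mc k) := ⟨fun _ => 0, fun _ _ _ => 0, fun _ _ => ∅, fun _ _ => ∅⟩

example : T1Text F Mc k (junkD F Mc k) E₀ κ := by
  refine ⟨fun K X => ?_, fun K X u hu => ?_, fun K X u u' _ => rfl⟩
  · intro z hz; exact absurd hz (Set.notMem_empty z)
  · exact absurd hu (Set.notMem_empty u)

/-- and with `Uc := univ`, `E := 0` it is inhabited whenever `0 ≤ E₀` (no chart constraint can exclude this one;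
only (S1)'s equation `Φf = Σ E ∘ χ ∘ ι` for the record's NON-ZERO `Φf` does). -/
def junkD' : FmtDataOver (recordDomSys F Mc k) := ⟨fun _ => 0, fun _ _ _ => 0, fun _ _ => Set.univ, fun _ _ => ∅⟩

example (hE : 0 ≤ E₀) : T1Text F Mc k (junkD' F Mc k) E₀ κ := by
  refine ⟨fun K X => ?_, fun K X u _ => ?_, fun K X u u' _ => rfl⟩
  · intro z _; exact analyticAt_const
  · show ‖(0:ℂ)‖ ≤ _
    rw [norm_zero]; positivity

end Summit.QuantumFields.YangMills.Cruxes.Record13SepCoPHInhabited.Crit1T1Junk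
end
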